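import Summits.QuantumFields.BalabanUV.Beta.FP.PerfectSymbol166HoloW
import Literature.MathematicalPhysics.QuantumFieldTheory.Balaban1983to89.Beta.AliasingTailL1

/-!
# `BalabanUV.Beta.FP.PerfectSymbol166StripReg` — road «FP» (binder row D1), sub-row **W166-HOLO** (supplier of row H2-P-KER = the owner's
# H2-DESIGN §5 input **(P-ii)** «analyticity on a strip from `W166Inf`'s strip analyticity»), PART B: **THE CONTINUUM (1.66) MULTIPLIER
# `W_∞ = W166Inf` IS STRIP-REGULAR** (`B4ContourShift.StripRegular`) on the zero-free strip `Strip (d+1) κ`, `0 ≤ κ ≤ κ₁₆₆(d+1)`, with bound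
# `MW (d+1)` — hence its lattice kernel decays exponentially —, and it is HOLOMORPHIC ON A UNIFORM FAT NEIGHBOURHOOD of the closed real zone

HONEST FRAMING (cell contract, verbatim): «discharging `BetaPertH` makes Bałaban's UV stability UNCONDITIONAL — a real constructive-QFT
result; it is NOT the continuum limit and NOT the Clay problem.»  HONEST DEPENDENCY (verbatim): «continuum YM on T⁴ ⇐ BetaPertH ∧ nine
spine estimates (0/9 proved); BetaPertH ⇐ (D1) ∧ (D4) ∧ CAP+tail; G-an2-4 gates asym, D1 and NE2/3/4.»  THIS MODULE DISCHARGES NOTHING of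
D1 / BetaPertH: [folklore] complex analysis / compactness bookkeeping over the road's OWN closed-form `k = ∞` multiplier and tree theorems BY NAME
(`stripRegular_W166` (finite `n`), `tendsto_W166`, `norm_W166lim_le`, `W166lim_eq_W166Inf`, `F66Inf_ne_zero`, PARTS A1/A2 of the sub-row, Mathlib
`IsCompact.exists_cthickening_subset_open`).  No `def … : Prop`; nothing is cited; 0 sorry.  NOT summit progress; NOT BetaPertH, NOT continuum,
NOT Clay.

ABSOLUTE RULE (cell, verbatim): «No internally-minted statement may enter as a cited fact. Every hypothesis is either kernel-proved in this
package or a verbatim quotation of a PUBLISHED theorem with page reference. The manuscript(s) under audit are NOT citable for their own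
disputed steps — they are the thing under adjudication; programme-internal (2001/route/tribunal) claims are never citable.»

CONTENT.
* §1 `W166Inf_sides` (matching values on the vertical sides `Re p_i = ±π` of the strip: the limit of `B5Symbol166Strip.W166_tr` through
  `stripRegular_W166 … |>.sides` and `tendsto_W166`), `norm_W166Inf_le_strip` (`‖W_∞‖ ≤ MW` on the strip), `rectO_eq_openRect` (currency bridge;
  `Beta.AliasingTailL1.update_insertNth_same` BY NAME), **`stripRegular_W166Inf`**: `StripRegular (fun p => W166Inf μ ν p) κ (MW (d+1))` for `μ ≠ ν`, `0 ≤ κ ≤ κ₁₆₆(d+1)` — the `k = ∞`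
  twin of `stripRegular_W166`, i.e. the owner's input (P-ii) BY NAME; consequences `latticeKernel_W166Inf_decay` (`‖K_{W_∞}(x)‖ ≤ MW·e^{−κ|x|_∞}`,
  `B4ContourShift.latticeKernel_decay`) and `integrableOn_integrand_W166Inf`.
* §2 A UNIFORM FAT NEIGHBOURHOOD OF THE STRIP ON WHICH `F_∞ ≠ 0`: the strip `Strip d κ` is compact, `F_∞` is continuous on the open fat box
  `FatO d (rOf d)` (PART A2), non-zero on `Strip d (κ₁₆₆ d)`; `IsCompact.exists_cthickening_subset_open` gives **`exists_fatStrip_F66Inf_ne_zero`**: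
  `∃ δ > 0` with `F_∞(p) ≠ 0` for every `p` of the fat strip `{|Re p_ν| ≤ π + δ, |Im p_ν| ≤ κ₁₆₆(d) + δ}` (which lies in `FatO d (rOf d)`); hence
  **`exists_fatStrip_differentiableAt_W166Inf_slice`**: on that fat strip `W_∞` is continuous and holomorphic in every coordinate slice — in
  particular ACROSS the seams `Re p_i = ±π` of the Brillouin zone, the input of the real-line derivative package (PART D).
* §3 the named constants (chosen once by `Classical.choose`): the fattening radius **`delta166 d`** (`δ₁₆₆ > 0`, `F_∞ ≠ 0` on
  `FatStrip d (κ₁₆₆ d) (δ₁₆₆ d)`, `continuousOn_W166Inf_fatStrip`, **`differentiableAt_W166Inf_slice_fatStripO`**) and the uniform bound **`bound166 d`**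
  (`‖W_∞‖ ≤ M₁₆₆` on that fat strip, all `μ ν`; `isCompact_fatStrip` + `IsCompact.exists_bound_of_continuousOn`).
Unit `b2b-balaban-beta-d1-formalise-leaf-01` (gen 8).
-/

noncomputable section

namespace Summit.QuantumFields.BalabanUV.Beta.FP.PerfectSymbol166StripReg

open Filter Topology Finset Complex Set Metric
open scoped BigOperators
open Literature.MathematicalPhysics.QuantumFieldTheory.Balaban1983to89
open B4Strip (Strip ofRealVec)
open B4StripCauchy (Fat strip_subset_fat rOf rOf_pos rOf_le d_mul_rOf_sq_le)
open B5Symbol166 (W166)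
open B5Symbol166Strip (kappa166 kappa166_pos kappa166_le_rOf MW MW_pos stripRegular_W166)
open B5Strip145Decay (differentiableAt_insertNth insertNth_left_mem)
open Beta.AliasingTailL1 (update_insertNth_same)
open B4ContourShift (StripRegular BZ closedRect openRect latticeKernel integrand insertNth_mem_Strip openRect_subset_closedRect
  latticeKernel_decay supNorm)
open T4Rate166StripDirect (norm_W166lim_le)
open Summit.QuantumFields.BalabanUV.Beta.FP.PerfectSymbolAlias
open Summit.QuantumFields.BalabanUV.Beta.FP.PerfectSymbol166
open Summit.QuantumFields.BalabanUV.Beta.FP.PerfectSymbol166Holo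
open Summit.QuantumFields.BalabanUV.Beta.FP.PerfectSymbol166HoloW

variable {d : ℕ}

/-! ## §1 Strip regularity of `W_∞` -/

/-- [folklore] **SIDE MATCHING**: for `q ∈ [-π,π]^d`, `|y| ≤ κ ≤ κ₁₆₆(d+1)` and `μ ≠ ν`,
`W_∞(μ,ν; insertNth i (−π + iy) q) = W_∞(μ,ν; insertNth i (π + iy) q)` (limit of the finite-`n` side matching of `stripRegular_W166`). -/
theorem W166Inf_sides {κ : ℝ} (hκ0 : 0 ≤ κ) (hκ : κ ≤ kappa166 (d + 1)) {μ ν : Fin (d + 1)} (hμν : μ ≠ ν) (i : Fin (d + 1))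
    {q : Fin d → ℝ} (hq : q ∈ BZ d) {y : ℝ} (hy : |y| ≤ κ) :
    W166Inf μ ν (i.insertNth (-Real.pi + y * I) (ofRealVec q)) = W166Inf μ ν (i.insertNth (Real.pi + y * I) (ofRealVec q)) := by
  have hL : (i.insertNth (-Real.pi + y * I) (ofRealVec q) : Fin (d + 1) → ℂ) ∈ Strip (d + 1) κ := (insertNth_left_mem hκ0 i hq hy).1
  have hR : (i.insertNth (Real.pi + y * I) (ofRealVec q) : Fin (d + 1) → ℂ) ∈ Strip (d + 1) κ := by
    refine insertNth_mem_Strip hκ0 i hq ⟨?_, ?_⟩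
    · simp [Real.pi_pos.le]
    · have : y ∈ Set.uIcc (-κ) κ := by
        rw [Set.uIcc_of_le (by linarith : -κ ≤ κ)]
        exact ⟨by linarith [neg_abs_le y], (le_abs_self y).trans hy⟩
      simpa using this
  have h1 := tendsto_W166 hκ0 hκ hL μ ν
  have h2 := tendsto_W166 hκ0 hκ hR μ ν
  have he : (fun j : ℕ => W166 (j + 1) μ ν (i.insertNth (-Real.pi + y * I) (ofRealVec q)))
      = fun j : ℕ => W166 (j + 1) μ ν (i.insertNth (Real.pi + y * I) (ofRealVec q)) := by
    funext j
    exact (stripRegular_W166 (j + 1) hκ0 hκ hμν).sides i q hq y hy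
  rw [he] at h1
  exact tendsto_nhds_unique h1 h2

/-- [folklore] **`‖W_∞(μ,ν;p)‖ ≤ MW d`** on the zero-free strip (`norm_W166lim_le` + `W166lim_eq_W166Inf`). -/
theorem norm_W166Inf_le_strip {κ : ℝ} (hκ0 : 0 ≤ κ) (hκ : κ ≤ kappa166 d) {p : Fin d → ℂ} (hp : p ∈ Strip d κ) (μ ν : Fin d) :
    ‖W166Inf μ ν p‖ ≤ MW d := by
  rw [← W166lim_eq_W166Inf hκ0 hκ hp μ ν]
  exact norm_W166lim_le hκ0 hκ hp μ ν

/-- [folklore] currency bridge: the open rectangle of `B4ContourShift` is `rectO`. -/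
theorem rectO_eq_openRect (κ : ℝ) : rectO κ = openRect κ := by
  ext z
  simp only [rectO, openRect, Set.mem_setOf_eq, Complex.mem_reProdIm, Set.mem_Ioo, abs_lt]

/-- [folklore] **STRIP REGULARITY OF THE CONTINUUM (1.66) MULTIPLIER** `W_∞(μ,ν;·)` (`μ ≠ ν`) on `ℂ^{d+1}`: continuous on the closed strip,
holomorphic in every coordinate slice through a real point, matching vertical sides, bounded by `MW (d+1)` — for every `0 ≤ κ ≤ κ₁₆₆(d+1)`.
This is the `k = ∞` twin of `B5Symbol166Strip.stripRegular_W166` and the owner's H2-DESIGN §5 input (P-ii) as a theorem. -/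
theorem stripRegular_W166Inf {κ : ℝ} (hκ0 : 0 ≤ κ) (hκ : κ ≤ kappa166 (d + 1)) {μ ν : Fin (d + 1)} (hμν : μ ≠ ν) :
    StripRegular (d := d) (fun p : Fin (d + 1) → ℂ => W166Inf μ ν p) κ (MW (d + 1)) := by
  refine ⟨continuousOn_W166Inf_strip hκ0 hκ μ ν, ?_, fun i q hq y hy => W166Inf_sides hκ0 hκ hμν i hq hy,
    fun p hp => norm_W166Inf_le_strip hκ0 hκ hp μ ν⟩
  intro i q hq
  have h0 : (0 : ℂ) ∈ closedRect κ := ⟨by simp [Real.pi_pos.le], by simp [hκ0]⟩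
  have hP : (i.insertNth (0 : ℂ) (ofRealVec q) : Fin (d + 1) → ℂ) ∈ Strip (d + 1) κ := insertNth_mem_Strip hκ0 i hq h0
  have h := differentiableOn_W166Inf_slice_strip hκ0 hκ hP i μ ν
  rw [rectO_eq_openRect] at h
  refine h.congr fun z _ => ?_
  show W166Inf μ ν (i.insertNth z (ofRealVec q)) = W166Inf μ ν (Function.update (i.insertNth 0 (ofRealVec q)) i z)
  rw [update_insertNth_same]

/-- [folklore] **EXPONENTIAL DECAY OF THE LATTICE KERNEL OF `W_∞`**: `‖(2π)^{−(d+1)} ∫_{[-π,π]^{d+1}} W_∞(μ,ν;p) e^{ip·x} dp‖ ≤ MW(d+1)·e^{−κ|x|_∞}`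
for every `0 ≤ κ ≤ κ₁₆₆(d+1)`, `μ ≠ ν` (`B4ContourShift.latticeKernel_decay`). -/
theorem latticeKernel_W166Inf_decay {κ : ℝ} (hκ0 : 0 ≤ κ) (hκ : κ ≤ kappa166 (d + 1)) {μ ν : Fin (d + 1)} (hμν : μ ≠ ν)
    (x : Fin (d + 1) → ℤ) :
    ‖latticeKernel (fun p : Fin (d + 1) → ℂ => W166Inf μ ν p) x‖ ≤ MW (d + 1) * Real.exp (-(κ * supNorm x)) :=
  latticeKernel_decay (stripRegular_W166Inf hκ0 hκ hμν) hκ0 x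

/-- [folklore] the Fourier integrand of `W_∞` is integrable on the real Brillouin zone. -/
theorem integrableOn_integrand_W166Inf {μ ν : Fin (d + 1)} (hμν : μ ≠ ν) (x : Fin (d + 1) → ℤ) :
    MeasureTheory.IntegrableOn (integrand (fun p : Fin (d + 1) → ℂ => W166Inf μ ν p) x) (BZ (d + 1)) :=
  (stripRegular_W166Inf le_rfl (kappa166_pos (d + 1)).le hμν).integrableOn le_rfl x

/-! ## §2 A uniform fat neighbourhood of the strip on which `F_∞ ≠ 0` -/

/-- [our object] the CLOSED FAT STRIP `{|Re p_ν| ≤ π + δ, |Im p_ν| ≤ κ + δ}` (for `δ = 0` this is `Strip d κ`). -/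
def FatStrip (d : ℕ) (κ δ : ℝ) : Set (Fin d → ℂ) := {q | ∀ ν, |(q ν).re| ≤ Real.pi + δ ∧ |(q ν).im| ≤ κ + δ}

/-- [folklore] `FatStrip d κ 0 = Strip d κ`. -/
theorem fatStrip_zero (κ : ℝ) : FatStrip d κ 0 = Strip d κ := by
  ext q; simp [FatStrip, Strip]

/-- [folklore] the strip lies in every fat strip of non-negative fattening. -/
theorem strip_subset_fatStrip {κ δ : ℝ} (hδ : 0 ≤ δ) : Strip d κ ⊆ FatStrip d κ δ :=
  fun _ hq ν => ⟨by linarith [(hq ν).1], by linarith [(hq ν).2]⟩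

/-- [folklore] the strip is compact (a finite product of closed rectangles). -/
theorem isCompact_strip (κ : ℝ) : IsCompact (Strip d κ) := by
  have e : Strip d κ = Set.pi Set.univ (fun _ : Fin d => (Set.Icc (-Real.pi) Real.pi ×ℂ Set.Icc (-κ) κ)) := by
    ext q
    simp only [Strip, Set.mem_setOf_eq, Set.mem_univ_pi, Complex.mem_reProdIm, Set.mem_Icc, abs_le]
  rw [e]
  exact isCompact_univ_pi fun _ => isCompact_Icc.reProdIm isCompact_Icc

/-- [folklore] clamping a real number of modulus `≤ a + δ` into `[-a, a]` moves it by at most `δ`. -/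
theorem abs_sub_clamp_le {a δ x : ℝ} (ha : 0 ≤ a) (hδ : 0 ≤ δ) (hx : |x| ≤ a + δ) : |x - max (-a) (min a x)| ≤ δ := by
  obtain ⟨h1, h2⟩ := abs_le.mp hx
  rcases le_total x a with hxa | hxa
  · rw [min_eq_right hxa]
    rcases le_total (-a) x with hax | hax
    · rw [max_eq_right hax, sub_self, abs_zero]; exact hδ
    · rw [max_eq_left hax, abs_le]; constructor <;> linarith
  · rw [min_eq_left hxa, max_eq_right (by linarith : -a ≤ a), abs_le]; constructor <;> linarith

/-- [folklore] the clamped value lies in `[-a, a]` (`0 ≤ a`). -/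
theorem abs_clamp_le {a x : ℝ} (ha : 0 ≤ a) : |max (-a) (min a x)| ≤ a :=
  abs_le.mpr ⟨le_max_left _ _, max_le (by linarith) (min_le_left _ _)⟩

/-- [folklore] every point of `FatStrip d κ δ` lies in the closed `(2δ)`-thickening of `Strip d κ` (`0 ≤ κ`, `0 ≤ δ`; sup metric on `Fin d → ℂ`:
clamp each coordinate's real and imaginary part). -/
theorem fatStrip_subset_cthickening {κ δ : ℝ} (hκ : 0 ≤ κ) (hδ : 0 ≤ δ) :
    FatStrip d κ δ ⊆ Metric.cthickening (2 * δ) (Strip d κ) := by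
  intro q hq
  set c : Fin d → ℂ := fun ν => (⟨max (-Real.pi) (min Real.pi (q ν).re), max (-κ) (min κ (q ν).im)⟩ : ℂ) with hc
  have hcS : c ∈ Strip d κ := fun ν => ⟨abs_clamp_le Real.pi_pos.le, abs_clamp_le hκ⟩
  have hdist : dist q c ≤ 2 * δ := by
    refine (dist_pi_le_iff (by positivity)).mpr fun ν => ?_
    rw [Complex.dist_eq]
    have hre : |(q ν - c ν).re| ≤ δ := by
      rw [Complex.sub_re]; exact abs_sub_clamp_le Real.pi_pos.le hδ (hq ν).1
    have him : |(q ν - c ν).im| ≤ δ := by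
      rw [Complex.sub_im]; exact abs_sub_clamp_le hκ hδ (hq ν).2
    calc ‖q ν - c ν‖ ≤ |(q ν - c ν).re| + |(q ν - c ν).im| := Complex.norm_le_abs_re_add_abs_im _
      _ ≤ δ + δ := add_le_add hre him
      _ = 2 * δ := by ring
  exact Metric.mem_cthickening_of_dist_le q c (2 * δ) _ hcS hdist

/-- [folklore] a fat strip with `δ ≤ rOf d` and `κ + δ ≤ 2·rOf d`, `δ` small, lies in the OPEN fat box `FatO d (rOf d)` (strict inequalities from
`δ < rOf d`, `κ + δ < 2 rOf d`). -/
theorem fatStrip_subset_fatO {κ δ : ℝ} (h1 : δ < rOf d) (h2 : κ + δ < 2 * rOf d) : FatStrip d κ δ ⊆ FatO d (rOf d) :=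
  fun _ hq ν => ⟨by linarith [(hq ν).1], by linarith [(hq ν).2]⟩

/-- [folklore] **A UNIFORM FAT STRIP ON WHICH `F_∞ ≠ 0`**: there is `δ > 0` (with `δ < rOf d`, `κ₁₆₆(d) + δ < 2·rOf d`) such that `F_∞(p) ≠ 0` for
every `p` with `|Re p_ν| ≤ π + δ`, `|Im p_ν| ≤ κ₁₆₆(d) + δ` (compactness of the strip, continuity of `F_∞` on the open fat box, `F66Inf_ne_zero` on
the strip). -/
theorem exists_fatStrip_F66Inf_ne_zero (d : ℕ) :
    ∃ δ : ℝ, 0 < δ ∧ δ < rOf d ∧ kappa166 d + δ < 2 * rOf d ∧ ∀ p ∈ FatStrip d (kappa166 d) δ, F66Inf p ≠ 0 := by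
  have hκ0 := (kappa166_pos d).le
  have hκr : kappa166 d ≤ rOf d := kappa166_le_rOf d
  have hr0 := rOf_pos d
  -- the open set `V = FatO ∩ {F ≠ 0}`
  have hcont : ContinuousOn (F66Inf (d := d)) (FatO d (rOf d)) :=
    (continuousOn_F66Inf (rOf_le d) (d_mul_rOf_sq_le d)).mono (fatO_subset_fat (rOf d))
  obtain ⟨V, hVopen, hV⟩ := (_root_.continuousOn_iff'.mp hcont) {w : ℂ | w ≠ 0} isOpen_ne
  -- `hV : F66Inf ⁻¹' {≠0} ∩ FatO = V ∩ FatO`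
  have hKU : Strip d (kappa166 d) ⊆ V ∩ FatO d (rOf d) := by
    intro p hp
    have hpF : p ∈ FatO d (rOf d) := fun ν => ⟨by linarith [(hp ν).1], by linarith [(hp ν).2]⟩
    have : p ∈ F66Inf ⁻¹' {w : ℂ | w ≠ 0} ∩ FatO d (rOf d) := ⟨F66Inf_ne_zero hκ0 le_rfl hp, hpF⟩
    rwa [hV] at this
  have hUopen : IsOpen (V ∩ FatO d (rOf d)) := hVopen.inter (isOpen_fatO d (rOf d))
  obtain ⟨ε, hε0, hε⟩ := (isCompact_strip (kappa166 d)).exists_cthickening_subset_open hUopen hKU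
  -- choose `δ` small: `2δ ≤ ε`, `δ < rOf`, `κ + δ < 2 rOf`
  set δ : ℝ := min (ε / 2) (rOf d / 2) with hδ
  have hδ0 : 0 < δ := lt_min (by linarith) (by linarith)
  have hδε : 2 * δ ≤ ε := by have := min_le_left (ε / 2) (rOf d / 2); linarith
  have hδr : δ < rOf d := by have := min_le_right (ε / 2) (rOf d / 2); linarith
  have hκδ : kappa166 d + δ < 2 * rOf d := by have := min_le_right (ε / 2) (rOf d / 2); linarith
  refine ⟨δ, hδ0, hδr, hκδ, fun p hp => ?_⟩
  have hpc : p ∈ Metric.cthickening ε (Strip d (kappa166 d)) :=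
    Metric.cthickening_mono hδε _ (fatStrip_subset_cthickening hκ0 hδ0.le hp)
  have hpV : p ∈ V ∩ FatO d (rOf d) := hε hpc
  have : p ∈ F66Inf ⁻¹' {w : ℂ | w ≠ 0} ∩ FatO d (rOf d) := by rw [hV]; exact hpV
  exact this.1

/-- [folklore] **HOLOMORPHY OF `W_∞` ON A UNIFORM FAT STRIP, INCLUDING ACROSS THE SEAMS `Re p_i = ±π`**: with the `δ` of
`exists_fatStrip_F66Inf_ne_zero`, for every `p` of the OPEN fat strip `{|Re p_ν| < π + δ, |Im p_ν| < κ₁₆₆(d) + δ}` and every coordinate `i`,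
`z ↦ W_∞(μ,ν; update p i z)` is holomorphic at `p i`, and `W_∞(μ,ν;·)` is continuous on the closed fat strip. -/
theorem exists_fatStrip_differentiableAt_W166Inf_slice (d : ℕ) :
    ∃ δ : ℝ, 0 < δ ∧ (∀ μ ν : Fin d, ContinuousOn (W166Inf μ ν) (FatStrip d (kappa166 d) δ)) ∧
      ∀ (μ ν i : Fin d) (p : Fin d → ℂ), (∀ ν', |(p ν').re| < Real.pi + δ ∧ |(p ν').im| < kappa166 d + δ) →
        DifferentiableAt ℂ (fun z : ℂ => W166Inf μ ν (Function.update p i z)) (p i) := by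
  obtain ⟨δ, hδ0, hδr, hκδ, hF⟩ := exists_fatStrip_F66Inf_ne_zero d
  have hsubO : FatStrip d (kappa166 d) δ ⊆ FatO d (rOf d) := fatStrip_subset_fatO hδr hκδ
  refine ⟨δ, hδ0, fun μ ν => ?_, fun μ ν i p hp => ?_⟩
  · exact (continuousOn_W166Inf (rOf_le d) (d_mul_rOf_sq_le d) μ ν).mono fun p hp =>
      ⟨fatO_subset_fat (rOf d) (hsubO hp), hF p hp⟩
  · have hpC : p ∈ FatStrip d (kappa166 d) δ := fun ν' => ⟨(hp ν').1.le, (hp ν').2.le⟩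
    have hpO : p ∈ FatO d (rOf d) := hsubO hpC
    exact differentiableAt_W166Inf_slice_fatO (rOf_le d) (d_mul_rOf_sq_le d) hpO (hF p hpC) i μ ν

/-! ## §3 The named fattening radius `δ₁₆₆(d)` and the uniform bound on the fat strip -/

/-- [our object] **THE FATTENING RADIUS** `δ₁₆₆(d) > 0`: a radius (chosen once, by `exists_fatStrip_F66Inf_ne_zero`) such that `F_∞ ≠ 0` on the fat
strip `FatStrip d (κ₁₆₆ d) (δ₁₆₆ d)`, with `δ₁₆₆(d) < rOf d` and `κ₁₆₆(d) + δ₁₆₆(d) < 2·rOf d`. -/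
def delta166 (d : ℕ) : ℝ := Classical.choose (exists_fatStrip_F66Inf_ne_zero d)

/-- [folklore] `0 < δ₁₆₆(d)`. -/
theorem delta166_pos (d : ℕ) : 0 < delta166 d := (Classical.choose_spec (exists_fatStrip_F66Inf_ne_zero d)).1

/-- [folklore] `δ₁₆₆(d) < rOf d`. -/
theorem delta166_lt_rOf (d : ℕ) : delta166 d < rOf d := (Classical.choose_spec (exists_fatStrip_F66Inf_ne_zero d)).2.1

/-- [folklore] `κ₁₆₆(d) + δ₁₆₆(d) < 2·rOf d`. -/
theorem kappa166_add_delta166_lt (d : ℕ) : kappa166 d + delta166 d < 2 * rOf d :=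
  (Classical.choose_spec (exists_fatStrip_F66Inf_ne_zero d)).2.2.1

/-- [folklore] **`F_∞ ≠ 0` on the fat strip of radius `δ₁₆₆(d)`.** -/
theorem F66Inf_ne_zero_fatStrip {p : Fin d → ℂ} (hp : p ∈ FatStrip d (kappa166 d) (delta166 d)) : F66Inf p ≠ 0 :=
  (Classical.choose_spec (exists_fatStrip_F66Inf_ne_zero d)).2.2.2 p hp

/-- [folklore] the fat strip of radius `δ₁₆₆(d)` lies in the open fat box `FatO d (rOf d)` (hence in `Fat d (rOf d)`). -/
theorem fatStrip_delta166_subset_fatO : FatStrip d (kappa166 d) (delta166 d) ⊆ FatO d (rOf d) :=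
  fatStrip_subset_fatO (delta166_lt_rOf d) (kappa166_add_delta166_lt d)

/-- [folklore] **`W_∞(μ,ν;·)` is continuous on the fat strip of radius `δ₁₆₆(d)`.** -/
theorem continuousOn_W166Inf_fatStrip (μ ν : Fin d) : ContinuousOn (W166Inf μ ν) (FatStrip d (kappa166 d) (delta166 d)) :=
  (continuousOn_W166Inf (rOf_le d) (d_mul_rOf_sq_le d) μ ν).mono fun _ hp =>
    ⟨fatO_subset_fat (rOf d) (fatStrip_delta166_subset_fatO hp), F66Inf_ne_zero_fatStrip hp⟩

/-- [our object] the OPEN fat strip `{|Re p_ν| < π + δ, |Im p_ν| < κ + δ}`. -/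
def FatStripO (d : ℕ) (κ δ : ℝ) : Set (Fin d → ℂ) := {q | ∀ ν, |(q ν).re| < Real.pi + δ ∧ |(q ν).im| < κ + δ}

/-- [folklore] `FatStripO ⊆ FatStrip`. -/
theorem fatStripO_subset_fatStrip (κ δ : ℝ) : FatStripO d κ δ ⊆ FatStrip d κ δ := fun _ hq ν => ⟨(hq ν).1.le, (hq ν).2.le⟩

/-- [folklore] **SLICE HOLOMORPHY OF `W_∞` ON THE OPEN FAT STRIP OF RADIUS `δ₁₆₆(d)`** — at every point, in every coordinate, in particular ACROSS
the seams `Re p_i = ±π` of the Brillouin zone. -/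
theorem differentiableAt_W166Inf_slice_fatStripO {p : Fin d → ℂ} (hp : p ∈ FatStripO d (kappa166 d) (delta166 d)) (i μ ν : Fin d) :
    DifferentiableAt ℂ (fun z : ℂ => W166Inf μ ν (Function.update p i z)) (p i) := by
  have hpC := fatStripO_subset_fatStrip _ _ hp
  have hpO : p ∈ FatO d (rOf d) := fatStrip_delta166_subset_fatO hpC
  exact differentiableAt_W166Inf_slice_fatO (rOf_le d) (d_mul_rOf_sq_le d) hpO (F66Inf_ne_zero_fatStrip hpC) i μ ν

/-- [folklore] the fat strip is compact. -/
theorem isCompact_fatStrip (κ δ : ℝ) : IsCompact (FatStrip d κ δ) := by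
  have e : FatStrip d κ δ = Set.pi Set.univ (fun _ : Fin d => (Set.Icc (-(Real.pi + δ)) (Real.pi + δ) ×ℂ Set.Icc (-(κ + δ)) (κ + δ))) := by
    ext q
    simp only [FatStrip, Set.mem_setOf_eq, Set.mem_univ_pi, Complex.mem_reProdIm, Set.mem_Icc, abs_le]
  rw [e]
  exact isCompact_univ_pi fun _ => isCompact_Icc.reProdIm isCompact_Icc

/-- [folklore] **A UNIFORM BOUND FOR `W_∞` ON THE FAT STRIP**: there is `M ≥ 0` with `‖W_∞(μ,ν;p)‖ ≤ M` for ALL `μ ν` and all `p` of the fat strip of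
radius `δ₁₆₆(d)` (compactness + continuity). -/
theorem exists_bound_W166Inf_fatStrip (d : ℕ) :
    ∃ M : ℝ, 0 ≤ M ∧ ∀ (μ ν : Fin d), ∀ p ∈ FatStrip d (kappa166 d) (delta166 d), ‖W166Inf μ ν p‖ ≤ M := by
  have hK := isCompact_fatStrip (d := d) (kappa166 d) (delta166 d)
  have hb : ∀ μ ν : Fin d, ∃ M : ℝ, 0 ≤ M ∧ ∀ p ∈ FatStrip d (kappa166 d) (delta166 d), ‖W166Inf μ ν p‖ ≤ M := by
    intro μ ν
    obtain ⟨M, hM⟩ := hK.exists_bound_of_continuousOn (continuousOn_W166Inf_fatStrip μ ν)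
    exact ⟨max M 0, le_max_right _ _, fun p hp => (hM p hp).trans (le_max_left _ _)⟩
  choose M hM0 hM using hb
  refine ⟨∑ μ, ∑ ν, M μ ν, Finset.sum_nonneg fun μ _ => Finset.sum_nonneg fun ν _ => hM0 μ ν, fun μ ν p hp => ?_⟩
  calc ‖W166Inf μ ν p‖ ≤ M μ ν := hM μ ν p hp
    _ ≤ ∑ ν', M μ ν' := Finset.single_le_sum (fun ν' _ => hM0 μ ν') (Finset.mem_univ ν)
    _ ≤ ∑ μ', ∑ ν', M μ' ν' := Finset.single_le_sum (fun μ' _ => Finset.sum_nonneg fun ν' _ => hM0 μ' ν') (Finset.mem_univ μ)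

/-- [our object] **THE UNIFORM BOUND** `M₁₆₆(d)` of `W_∞` on the fat strip of radius `δ₁₆₆(d)` (chosen once). -/
def bound166 (d : ℕ) : ℝ := Classical.choose (exists_bound_W166Inf_fatStrip d)

/-- [folklore] `0 ≤ M₁₆₆(d)`. -/
theorem bound166_nonneg (d : ℕ) : 0 ≤ bound166 d := (Classical.choose_spec (exists_bound_W166Inf_fatStrip d)).1

/-- [folklore] **`‖W_∞(μ,ν;p)‖ ≤ M₁₆₆(d)` on the fat strip of radius `δ₁₆₆(d)`.** -/
theorem norm_W166Inf_le_bound166 (μ ν : Fin d) {p : Fin d → ℂ} (hp : p ∈ FatStrip d (kappa166 d) (delta166 d)) :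
    ‖W166Inf μ ν p‖ ≤ bound166 d :=
  (Classical.choose_spec (exists_bound_W166Inf_fatStrip d)).2 μ ν p hp

end Summit.QuantumFields.BalabanUV.Beta.FP.PerfectSymbol166StripReg

end
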